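import Summits.ResolutionOfSingularities.ResolutionOfSingularities.Theorems.MarkedTransferCampaignW46ThreefoldsSigmaCurveStep
import HarnessLib

/-!
# [OURS · L1 W4.6 rung (ii-τ2)] THE SINGULAR-CURVE `τ ≥ 2` SLICE AT d = 3 — an input whose order-`μ` locus is ONE integral
# curve, POSSIBLY SINGULAR, all of whose closed points have `τ ≥ 2`, is order-reducible: finitely many point blow-ups make the
# curve regular (Σ δ drops), then one blowing up of the curve finishes; PROVED

Cell res-hironaka, LADDER-RESOLUTION rung L (D-0089), slot W4.6, rung (ii) (threefold hypersurfaces); seat res-L1-s46-pv-3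
(gen 4; rev 2 = module docstring only: honest caveat added, declarations byte-identical). Host route MarkedTransfer, host item `HypersurfaceOrderReductionDimLeThree` (stmt-ResolutionOfSingularities-16156);
filed `--kind proof --supports` it `--as helper`. Assembly of the step `SigmaCurveState.exists_step_of_not_mem_regularLocus`
(p521627) with the curve slice in closed-point form (p520244): steps 1 and 4 of the algorithm of Cossart–Piltant 2008 Prop. 4.4
in the `τ ≥ 2` branch for an irreducible one-dimensional `Σ`. OURS scheme theory over PROVED tree lemmas (near points, strict
transforms and their `δ`, the tree's «regular curve of a threefold is cut out by two regular parameters»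
`exists_isRsopPart_fin_two_of_specializes`); nothing of H. Hironaka's manuscript is asserted. AI-written; AI review is weaker than
expert review.

## What is proved (no definitions)

* `CampaignW46.SigmaCurveState.orderReducible_of_isRegular` — END: a stage whose curve is regular is settled by the curve slice.
* `CampaignW46.SigmaCurveState.orderReducible_base` — from ANY stage, `(X₀, J₀, μ)` is order-reducible (well-founded induction
  on `Σ δ`: blow up singular points of the curve until it is regular).
* `CampaignW46.orderReducible_of_integralCurve_two_le_tau` — **THE SINGULAR-CURVE `τ ≥ 2` SLICE**: `X` regular, locally
  Noetherian and quasi-compact, `J`, `μ ≥ 1` its maximal order; if the locus of order `μ` is the image of an integral Noetherian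
  quasi-excellent curve `C` of codimension `2` (closed immersion, generic point not closed, of coheight `> 1`) and its CLOSED
  points are threefold points with Hironaka `τ ≥ 2`, then `(X, J, μ)` is ORDER-REDUCIBLE.
* `CampaignW46.gammaFreeGlobalDimLE_integralCurve_two_le_tau_slice (p d)` — the same in the binders of the Γ-free ladder.

HONEST VALUE — READ THE CAVEAT. What this file PROVES is correct; what it ADDS beyond the regular-curve slices (p517124, p520244)
is doubtful: at a SINGULAR closed point `x` of an irreducible curve component `C` of the top locus `Σ_μ` the hypothesis
`τ_x ≥ 2` is essentially never satisfied — for `μ = 2` (double points) it is IMPOSSIBLE in every characteristic (`f ∈ P_C^(2)`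
forces every partial derivative of `in₂ f` to be a multiple of the one linear form in `P_C + 𝔪²/𝔪²`, whence `in₂ f = c ℓ²`, or a
square over a perfect field of characteristic `2`: `τ ≤ 1`), and for every `μ` in characteristic `0` or `p > μ` by the same
argument with `(μ−1)`-st derivatives (Zariski–Nagata); only `p ≤ μ`, `μ ≥ 3` is not excluded by it, and no example is known to
the author. The value of this file is therefore STRUCTURAL: step 1 of Cossart–Piltant's algorithm (blow up the singular points of
the one-dimensional components of `Σ`; `Σ′` is the strict transform; termination by `Σ δ`) is mechanised in the campaign's
currency, as the template for the `τ = 1` version (polygon invariants; over a `τ = 1` point `Σ′` can be a projective line,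
CP2008 Lemma 4.3 (5)). Still outside in any case: `τ = 1` points, several curve components, `μ` below the maximal order.

References: `…ThreefoldsSigmaCurveStep.lean` (p521627), `…ThreefoldsCurveSliceClosedPoints.lean` (p520244), tree
`Resolution/CurveCentreTwoParameters.lean` (`exists_isRsopPart_fin_two_of_specializes` [CossartPiltant2008, proof of Prop. 4.2]),
`Resolution/AlterationsNormalFormStrictTransform.lean` (`isRegular_subscheme_vanishingIdeal_range`); no G-ring hypothesis is
needed (no isolated points). [CossartPiltant2008] H. Hironaka, ms. 2017-03-23 — scope only, under adjudication, not cited as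
fact. [Hironaka2017]
-/

noncomputable section

set_option linter.dupNamespace false -- mandated namespace of this single-conjunct summit

open CategoryTheory AlgebraicGeometry TopologicalSpace IsLocalRing

namespace Summit.ResolutionOfSingularities.ResolutionOfSingularities.Theorems

namespace CampaignW46

open Literature.AlgebraicGeometry.Resolution
open Scheme.IdealSheafData
open Literature.AlgebraicGeometry.Hironaka2017

universe u

namespace SigmaCurveState

variable {X₀ : Scheme.{u}} {J₀ : X₀.IdealSheafData} {μ : ℕ}

set_option maxHeartbeats 800000 in
/-- **END OF THE Σ-REGULARISATION: a stage whose curve is REGULAR is order-reducible** — by the curve slice in closed-point form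
(p520244): the reduced closed subscheme on `i(C)` is regular (`isRegular_subscheme_vanishingIdeal_range`), at each closed point of
`i(C)` its ideal is cut out by two regular parameters (the tree's `exists_isRsopPart_fin_two_of_specializes`: a regular curve
through a threefold point) and `τ ≥ 2`. [cite: CossartPiltant2008, Lemma 4.3 (2); proof of Prop. 4.4] -/
theorem orderReducible_of_isRegular (hm : 1 ≤ μ) (σ : SigmaCurveState X₀ J₀ μ) (hC : Scheme.IsRegular σ.C) :
    OrderReducible σ.J μ := by
  haveI := σ.locNoeth
  haveI := σ.cpt
  haveI := σ.ci
  haveI := σ.int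
  have hX := σ.reg
  set Y : Closeds σ.X := ⟨Set.range σ.i, σ.i.isClosedEmbedding.isClosed_range⟩ with hYdef
  have hreg : Scheme.IsRegular (vanishingIdeal Y).subscheme := isRegular_subscheme_vanishingIdeal_range σ.i hC
  have hYcl : (Y : Set σ.X) = closure {σ.i (genericPoint σ.C)} := by
    apply le_antisymm
    · rintro _ ⟨c, rfl⟩
      exact specializes_iff_mem_closure.mp (σ.generic_specializes c)
    · exact closure_minimal (Set.singleton_subset_iff.mpr ⟨_, rfl⟩) σ.isClosed_range
  refine orderReducible_of_curve_two_le_tau_closedPoints hX σ.J hm Y hreg (fun z hz => (σ.sigma z).mp hz)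
    (fun y hy => σ.idealOrder_eq hy) fun y hy hyc => ?_
  obtain ⟨c, rfl⟩ := hy
  haveI : IsRegularLocalRing (σ.X.presheaf.stalk (σ.i c)) := hX _
  have hcη : c ≠ genericPoint σ.C := by
    rintro rfl
    exact σ.notClosed hyc
  have hηx : σ.i (genericPoint σ.C) ⤳ σ.i c := σ.generic_specializes c
  have hxη : ¬ σ.i c ⤳ σ.i (genericPoint σ.C) := by
    intro h
    have hmem : σ.i (genericPoint σ.C) ∈ closure ({σ.i c} : Set σ.X) := specializes_iff_mem_closure.mp h
    rw [hyc.closure_eq, Set.mem_singleton_iff] at hmem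
    exact hcη (σ.i.isClosedEmbedding.injective hmem).symm
  have hx3 : Order.coheight (σ.i c) ≤ 3 := by
    rw [coheight_eq_spanFinrank (σ.i c), σ.dim3 _ ⟨c, rfl⟩ hyc]; rfl
  obtain ⟨cc, hcr, hcY⟩ := exists_isRsopPart_fin_two_of_specializes hreg hYcl hηx hxη σ.coh hx3
  exact ⟨cc, hcr, hcY, σ.tau _ ⟨c, rfl⟩ hyc⟩

/-- **From any stage, `(X₀, J₀, μ)` is order-reducible**: well-founded induction on the measure `Σ δ(C)` — if the curve is regular
the stage is settled (`orderReducible_of_isRegular`) and the sequence of permissible blowing-ups leading to it composes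
(`OrderReducible.of_isPermissibleBlowupSeq`); otherwise blow up a singular point (`exists_step_of_not_mem_regularLocus`) and
recurse. [cite: CossartPiltant2008, proof of Prop. 4.4] -/
theorem orderReducible_base (hm : 1 ≤ μ) (σ : SigmaCurveState X₀ J₀ μ) : OrderReducible J₀ μ := by
  suffices key : ∀ n : ℕ∞, ∀ σ : SigmaCurveState X₀ J₀ μ, σ.delta = n → OrderReducible J₀ μ from key _ σ rfl
  intro n
  induction n using WellFoundedLT.induction with
  | ind n ih =>
    intro σ hn
    by_cases hC : Scheme.IsRegular σ.C
    · exact OrderReducible.of_isPermissibleBlowupSeq σ.seq (σ.orderReducible_of_isRegular hm hC)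
    · obtain ⟨c, hc⟩ : ∃ c : σ.C, c ∉ Scheme.regularLocus σ.C := by
        by_contra h
        push Not at h
        exact hC fun c => h c
      obtain ⟨σ', hlt⟩ := σ.exists_step_of_not_mem_regularLocus hm hc
      exact ih σ'.delta (hn ▸ hlt) σ' rfl

end SigmaCurveState

/-! ## The singular-curve `τ ≥ 2` slice -/

/-- **THE SINGULAR-CURVE `τ ≥ 2` SLICE.** `X` regular, locally Noetherian and quasi-compact; `J` an ideal sheaf; `μ ≥ 1` with
`ord_z J ≤ μ` everywhere; `i : C ↪ X` a closed immersion of an integral Noetherian quasi-excellent scheme of dimension `≤ 1`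
whose image is EXACTLY the locus of order `μ`, with `i(η_C)` not closed and of coheight `> 1` (a genuine curve of codimension
`2`, possibly SINGULAR), every closed point of which is a threefold point with Hironaka `τ ≥ 2`. Then `(X, J, μ)` is
ORDER-REDUCIBLE by permissible blowing-ups (point blow-ups regularising the curve, then the curve).
[cite: CossartPiltant2008, Prop. 4.4 (proof, steps 1 and 4)] -/
theorem orderReducible_of_integralCurve_two_le_tau {X : Scheme.{u}} [IsLocallyNoetherian X] [CompactSpace X]
    (hX : Scheme.IsRegular X) (J : X.IdealSheafData) {μ : ℕ} (hm : 1 ≤ μ) {C : Scheme.{u}} (i : C ⟶ X)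
    [IsClosedImmersion i] [IsIntegral C] [IsNoetherian C] (hCq : Scheme.IsQuasiExcellent C)
    (hdim : topologicalKrullDim C ≤ 1) (hη : ¬ IsClosed ({i (genericPoint C)} : Set X))
    (hcoh : 1 < Order.coheight (i (genericPoint C)))
    (hS : ∀ z : X, (μ : ℕ∞) ≤ idealOrder J z ↔ z ∈ Set.range i) (htop : ∀ z : X, idealOrder J z ≤ μ)
    (hdim3 : ∀ z ∈ Set.range i, IsClosed ({z} : Set X) → (maximalIdeal (X.presheaf.stalk z)).spanFinrank = 3)
    (hτ : ∀ z ∈ Set.range i, IsClosed ({z} : Set X) → haveI := hX z; 2 ≤ stalkTau J z μ) :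
    OrderReducible J μ :=
  SigmaCurveState.orderReducible_base hm
    ⟨X, J, 𝟙 X, inferInstance, inferInstance, hX, IsPermissibleBlowupSeq.nil, C, i, inferInstance, inferInstance,
      inferInstance, hCq, hdim, hη, hcoh, hS, htop, hdim3, hτ⟩

/-- **THE SINGULAR-CURVE `τ ≥ 2` SLICE OF EVERY RUNG OF THE Γ-FREE LADDER** (`GammaFreeGlobalOrderReductionDimLE p d`, p496755):
its binders, plus «`m` is the maximal order and the locus of order `m` is an integral (possibly singular) curve of codimension `2`
whose closed points are threefold points with `τ ≥ 2`», give `OrderReducible I m`, unconditionally.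
[cite: CossartPiltant2008, Prop. 4.4] -/
theorem gammaFreeGlobalDimLE_integralCurve_two_le_tau_slice (p d : ℕ) :
    p.Prime → ∀ (k : Type u) [Field k] [CharP k p] [PerfectField k] (X : Scheme.{u}) (s : X ⟶ Spec (.of k)),
      IsSeparated s → LocallyOfFiniteType s → QuasiCompact s → IsIntegral X → ∀ (hreg : Scheme.IsRegular X),
        topologicalKrullDim X ≤ d → ∀ (I : X.IdealSheafData), I ≠ ⊥ → IsEffectiveCartier I → ∀ (m : ℕ), 1 ≤ m →
          ∀ (C : Scheme.{u}) (i : C ⟶ X) [IsClosedImmersion i] [IsIntegral C] [IsNoetherian C],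
            Scheme.IsQuasiExcellent C → topologicalKrullDim C ≤ 1 → ¬ IsClosed ({i (genericPoint C)} : Set X) →
              1 < Order.coheight (i (genericPoint C)) →
              (∀ z : X, (m : ℕ∞) ≤ idealOrder I z ↔ z ∈ Set.range i) → (∀ z : X, idealOrder I z ≤ m) →
                (∀ z ∈ Set.range i, IsClosed ({z} : Set X) → (maximalIdeal (X.presheaf.stalk z)).spanFinrank = 3) →
                  (∀ z ∈ Set.range i, IsClosed ({z} : Set X) → haveI := hreg z; 2 ≤ stalkTau I z m) →
                    OrderReducible I m := by
  intro _ k _ _ _ X s _ hloft hqc _ hreg _ I _ _ m hm C i _ _ _ hCq hdim hη hcoh hS htop hdim3 hτ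
  haveI : IsLocallyNoetherian X := LocallyOfFiniteType.isLocallyNoetherian s
  haveI : CompactSpace X := QuasiCompact.compactSpace_of_compactSpace s
  exact orderReducible_of_integralCurve_two_le_tau hreg I hm i hCq hdim hη hcoh hS htop hdim3 hτ

end CampaignW46

end Summit.ResolutionOfSingularities.ResolutionOfSingularities.Theorems

end
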